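import Literature.NumberTheory.Sieve.Maynard2016Lemma6PairBound
import Literature.NumberTheory.Sieve.Maynard2016MainSumLink
import Literature.NumberTheory.Sieve.Maynard2016I1Expand
import Literature.NumberTheory.Sieve.Maynard2016Lemma6Split
import Literature.NumberTheory.Sieve.Maynard2016Lemma6CountingProof

/-!
# Maynard (2016), Lemma 6: the main-term asymptotic `Lemma6MainTerm` — PROVED

Trunk: AntSieve / parity (Maynard 2016 large-gaps ladder).  This file closes the named fact
`Literature.NumberTheory.Sieve.Maynard2016.Lemma6MainTerm` of `Maynard2016Lemma6Split.lean`
(the kernel frontier of `Maynard2016_theorem1` on the Lemma 6 side): J. Maynard, *Large gaps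
between primes*, Ann. of Math. 183 (2016) = arXiv:1408.5110, §6, proof of Lemma 6, displays
(6.8)–(6.20) — uniformly for `1 ≤ m < U/(z log₂² x)` and primes `x/2 ≤ q ≤ x`,
`(log x)^k (log y)^k · Σ_{j,j'} c_j c_{j'} S_{j,j'} = (1 + o(1)) 𝔖_{m,q} I_k^{(1)}(F) I_k^{(2)}(G)`
with `𝔖_{m,q} = ∏_{p≤w}(1−1/p)^{−2k} ∏_{w<p≤y}(1−ω(p)/p)(1−1/p)^{−2k}`.
Proof: `mainSum = Σ c_j c_{j'} S_{j,j'}` (`ofReal_mainSum_eq`), the one-pair estimate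
`eventually_norm_logpow_mul_coupledLcmSum_sub_le` for each of the finitely many pairs `(j,j')`,
and `I_k^{(1)}(F) I_k^{(2)}(G) = Σ c_j c_{j'} (∏_ℓ ∫ F'_{ℓ,j} F'_{ℓ,j'}) (∏_ℓ ∫ G'G')`
(`IsSieveData.I1_eq_sum`, `I2_eq_prod`).  Consequently `Lemma6` holds unconditionally
(`maynard2016_lemma6_holds`, from `lemma6_of_counting_mainTerm` and `lemma6Counting_holds`).

## References

* J. Maynard, *Large gaps between primes*, Ann. of Math. (2) 183 (2016), 915–933; arXiv:1408.5110,
  §6, Lemma 6 and its proof, displays (6.8)–(6.20). [Maynard2016LargeGaps]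
-/

noncomputable section

open Filter Finset Real MeasureTheory
open scoped BigOperators Topology

namespace Literature.NumberTheory.Sieve

namespace Maynard2016

open LcmEuler

/-- The range of `m` in Lemma 6 lies below `x`: `U/(z log₂² x) = C_U log y/log₂² x ≤ x` eventually.
[cite: Maynard2016LargeGaps, §6 statement of Lemma 6] -/
theorem eventually_U_div_le {C_U ε : ℝ} (hCU : 0 < C_U) (hε0 : 0 ≤ ε) (hε : ε ≤ 1 / 2) :
    ∀ᶠ x : ℕ in atTop, U C_U ε x / (z x * (Real.log (Real.log x)) ^ 2) ≤ x := by
  have hT : Tendsto (fun x : ℕ => Real.log (x : ℝ)) atTop atTop :=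
    Real.tendsto_log_atTop.comp tendsto_natCast_atTop_atTop
  filter_upwards [eventually_iteratedLogs, hT.eventually_ge_atTop C_U, eventually_gt_atTop 0]
    with x hlogs hC hx0
  obtain ⟨hL, hL2, hL3, hL3L2, hL2L, hLx, hL2x⟩ := hlogs
  have hx0' : (0 : ℝ) < x := by exact_mod_cast hx0
  have hL0 : 0 < Real.log x := by linarith
  have hL20 : 0 < Real.log (Real.log x) := by linarith
  have hly : 0 < Real.log (y ε x) := log_y_pos hε hL20 (by linarith) hL3
  -- `log y ≤ log x`
  have hlyx : Real.log (y ε x) ≤ Real.log x := by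
    rw [log_y]
    have h1 : Real.log (Real.log (Real.log x)) / Real.log (Real.log x) ≤ 1 := by
      rw [div_le_one hL20]; linarith
    have hT0 : 0 ≤ Real.log x * Real.log (Real.log (Real.log x)) / Real.log (Real.log x) := by
      positivity
    have hT1 : Real.log x * Real.log (Real.log (Real.log x)) / Real.log (Real.log x) ≤ Real.log x := by
      rw [mul_div_assoc]
      exact mul_le_of_le_one_right hL0.le h1
    calc (1 - ε) * (Real.log x * Real.log (Real.log (Real.log x)) / Real.log (Real.log x))
        ≤ 1 * (Real.log x * Real.log (Real.log (Real.log x)) / Real.log (Real.log x)) :=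
          mul_le_mul_of_nonneg_right (by linarith) hT0
      _ ≤ Real.log x := by rw [one_mul]; exact hT1
  have hid : U C_U ε x / (z x * (Real.log (Real.log x)) ^ 2) =
      C_U * Real.log (y ε x) / (Real.log (Real.log x)) ^ 2 := by
    unfold U z
    field_simp
  rw [hid, div_le_iff₀ (by positivity)]
  calc C_U * Real.log (y ε x) ≤ Real.log x * Real.log x :=
        mul_le_mul hC hlyx hly.le (by linarith)
    _ = (Real.log x) ^ 2 := by ring
    _ ≤ x := hL2x
    _ ≤ x * (Real.log (Real.log x)) ^ 2 := le_mul_of_one_le_right hx0'.le (by nlinarith)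

/-- **Maynard (2016), Lemma 6, main term** ((6.8)–(6.20)): the named fact `Lemma6MainTerm` holds.
[cite: Maynard2016LargeGaps, Lemma 6] -/
theorem lemma6MainTerm_holds : Lemma6MainTerm := by
  intro C_U hCU
  have hε' : ∀ᶠ ε : ℝ in 𝓝[>] 0, 0 < ε ∧ ε ≤ 1 / 2 := by
    have h1 : ∀ᶠ ε : ℝ in 𝓝[>] 0, ε ∈ Set.Ioi (0 : ℝ) := eventually_mem_nhdsWithin
    have h2 : ∀ᶠ ε : ℝ in 𝓝[>] 0, ε ≤ 1 / 2 :=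
      (eventually_le_nhds (by norm_num : (0 : ℝ) < 1 / 2)).filter_mono nhdsWithin_le_nhds
    filter_upwards [h1, h2] with ε h h'
    exact ⟨h, h'⟩
  filter_upwards [hε'] with ε hεε
  obtain ⟨hε0, hε⟩ := hεε
  intro k hk J c Fd G hSD hI1 hI2 κ hκ
  -- the accuracy demanded of each pair
  set Cabs : ℝ := ∑ j, ∑ j', |c j * c j'| with hCabs
  have hCabs0 : 0 ≤ Cabs := by positivity
  have hII : 0 < I1 c Fd * I2 k G := mul_pos hI1 hI2
  set η : ℝ := κ * (I1 c Fd * I2 k G) / (Cabs + 1) with hη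
  have hη0 : 0 < η := by positivity
  have hηC : η * Cabs ≤ κ * (I1 c Fd * I2 k G) := by
    rw [hη, div_mul_eq_mul_div, div_le_iff₀ (by positivity)]
    have : 0 ≤ κ * (I1 c Fd * I2 k G) := by positivity
    nlinarith
  -- the one-pair estimates, for all pairs at once
  have hpair : ∀ jj : Fin J × Fin J, ∀ᶠ x : ℕ in atTop, ∀ m q : ℕ, 1 ≤ m → m ≤ x → q.Prime →
      (x : ℝ) / 2 ≤ q → q ≤ x →
      ‖(Real.log x : ℂ) ^ k * (Real.log (y ε x) : ℂ) ^ k *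
            coupledLcmSum (Pw x) m (couplingSet k x m q) (fun ℓ => Fd ℓ jj.1) (fun ℓ => Fd ℓ jj.2)
              (fun _ : Fin k => G) (fun _ => G) (x : ℝ) (y ε x) x -
          ((singSmall k x * singLarge k ε x m q : ℝ) : ℂ) *
            pairConst (fun ℓ => Fd ℓ jj.1) (fun ℓ => Fd ℓ jj.2) (fun _ : Fin k => G) (fun _ => G)‖ ≤
        η * (singSmall k x * singLarge k ε x m q) := fun jj =>
    eventually_norm_logpow_mul_coupledLcmSum_sub_le (fun ℓ => hSD.isSieveCutoff_Fd ℓ jj.1)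
      (fun ℓ => hSD.isSieveCutoff_Fd ℓ jj.2) (fun _ => hSD.isSieveCutoff_G) (fun _ => hSD.isSieveCutoff_G)
      hε0 hε (fun _ => ⟨by norm_num, by norm_num⟩) (fun _ => ⟨le_rfl, le_rfl⟩) hη0
  -- `I1 · I2 = Σ c_j c_j' · pairConst`
  have hI : ((I1 c Fd * I2 k G : ℝ) : ℂ) = ∑ j, ∑ j', (c j : ℂ) * c j' *
      pairConst (fun ℓ => Fd ℓ j) (fun ℓ => Fd ℓ j') (fun _ : Fin k => G) (fun _ => G) := by
    have hreal : I1 c Fd * I2 k G = ∑ j, ∑ j', c j * c j' *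
        ((∏ ℓ, ∫ t in Set.Ioi (0 : ℝ), deriv (Fd ℓ j) t * deriv (Fd ℓ j') t) *
          ∏ _ℓ : Fin k, ∫ t in Set.Ioi (0 : ℝ), deriv G t * deriv G t) := by
      rw [hSD.I1_eq_sum, I2_eq_prod, Finset.sum_mul]
      refine Finset.sum_congr rfl fun j _ => ?_
      rw [Finset.sum_mul]
      refine Finset.sum_congr rfl fun j' _ => ?_
      ring
    rw [hreal]
    push_cast
    refine Finset.sum_congr rfl fun j _ => Finset.sum_congr rfl fun j' _ => ?_
    unfold pairConst
    push_cast
    ring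
  filter_upwards [(eventually_all.2 hpair), eventually_U_div_le hCU hε0.le hε,
    eventually_half_le_singLarge hε0 hε k] with x hx hmB hhalf
  intro m hm1 _hmE hmU q hq hqx2 hqx
  have hmx : m ≤ x := by
    have : (m : ℝ) ≤ x := by linarith [hmU.le.trans hmB]
    exact_mod_cast this
  have hqx' : q ≤ x := by exact_mod_cast hqx
  set S₀ : ℝ := singSmall k x * singLarge k ε x m q with hS₀
  have hS0 : 0 ≤ S₀ := by
    have := hhalf m q hm1 hmx hq hqx2 hqx'
    have := singSmall_pos k x
    positivity
  set L : ℂ := (Real.log x : ℂ) ^ k * (Real.log (y ε x) : ℂ) ^ k with hLdef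
  have key : ∀ j j' : Fin J,
      ‖L * coupledLcmSum (Pw x) m (couplingSet k x m q) (fun ℓ => Fd ℓ j) (fun ℓ => Fd ℓ j')
            (fun _ : Fin k => G) (fun _ => G) (x : ℝ) (y ε x) x -
          (S₀ : ℂ) * pairConst (fun ℓ => Fd ℓ j) (fun ℓ => Fd ℓ j') (fun _ : Fin k => G) (fun _ => G)‖ ≤
        η * S₀ := fun j j' => hx (j, j') m q hm1 hmx hq hqx2 hqx'
  -- the difference as a double sum
  have hmain := ofReal_mainSum_eq c Fd G ε x m q
  have hdiff : ((mainSum c Fd G ε x m q * Real.log x ^ k * Real.log (y ε x) ^ k -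
      singSmall k x * singLarge k ε x m q * I1 c Fd * I2 k G : ℝ) : ℂ) =
      ∑ j, ∑ j', (c j : ℂ) * c j' *
        (L * coupledLcmSum (Pw x) m (couplingSet k x m q) (fun ℓ => Fd ℓ j) (fun ℓ => Fd ℓ j')
            (fun _ : Fin k => G) (fun _ => G) (x : ℝ) (y ε x) x -
          (S₀ : ℂ) * pairConst (fun ℓ => Fd ℓ j) (fun ℓ => Fd ℓ j') (fun _ : Fin k => G) (fun _ => G)) := by
    have e1 : ((mainSum c Fd G ε x m q * Real.log x ^ k * Real.log (y ε x) ^ k : ℝ) : ℂ) =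
        L * (mainSum c Fd G ε x m q : ℂ) := by
      rw [Complex.ofReal_mul, Complex.ofReal_mul, Complex.ofReal_pow, Complex.ofReal_pow, hLdef]; ring
    have e2 : ((singSmall k x * singLarge k ε x m q * I1 c Fd * I2 k G : ℝ) : ℂ) =
        (S₀ : ℂ) * ((I1 c Fd * I2 k G : ℝ) : ℂ) := by
      rw [hS₀, Complex.ofReal_mul, Complex.ofReal_mul, Complex.ofReal_mul, Complex.ofReal_mul]; ring
    rw [Complex.ofReal_sub, e1, e2, hmain, hI, Finset.mul_sum, Finset.mul_sum, ← Finset.sum_sub_distrib]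
    refine Finset.sum_congr rfl fun j _ => ?_
    rw [Finset.mul_sum, Finset.mul_sum, ← Finset.sum_sub_distrib]
    refine Finset.sum_congr rfl fun j' _ => ?_
    ring
  rw [← Real.norm_eq_abs, ← Complex.norm_real, hdiff]
  calc ‖∑ j, ∑ j', (c j : ℂ) * c j' *
        (L * coupledLcmSum (Pw x) m (couplingSet k x m q) (fun ℓ => Fd ℓ j) (fun ℓ => Fd ℓ j')
            (fun _ : Fin k => G) (fun _ => G) (x : ℝ) (y ε x) x -
          (S₀ : ℂ) * pairConst (fun ℓ => Fd ℓ j) (fun ℓ => Fd ℓ j') (fun _ : Fin k => G) (fun _ => G))‖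
      ≤ ∑ j, ∑ j', |c j * c j'| * (η * S₀) := by
        refine (norm_sum_le _ _).trans (Finset.sum_le_sum fun j _ =>
          (norm_sum_le _ _).trans (Finset.sum_le_sum fun j' _ => ?_))
        rw [norm_mul, norm_mul, Complex.norm_real, Complex.norm_real, Real.norm_eq_abs,
          Real.norm_eq_abs, ← abs_mul]
        exact mul_le_mul_of_nonneg_left (key j j') (abs_nonneg _)
    _ = η * Cabs * S₀ := by
        rw [hCabs]
        simp_rw [← Finset.sum_mul]
        ring
    _ ≤ κ * (I1 c Fd * I2 k G) * S₀ := mul_le_mul_of_nonneg_right hηC hS0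
    _ = κ * (singSmall k x * singLarge k ε x m q * I1 c Fd * I2 k G) := by rw [hS₀]; ring

/-- `Lemma6MainTerm` — `_holds` alias of `lemma6MainTerm_holds` above under the fact's exact name (appended
2026-08-28, D-0026 bookkeeping: the proof term is the existing theorem of this file; no statement,
definition or attribute is edited; no new named fact; the ledger's debt table listed the fact
unproved). [cite: Maynard2016LargeGaps, Lemma 6] -/
theorem _root_.Literature.NumberTheory.Sieve.Maynard2016.Lemma6MainTerm_holds : Lemma6MainTerm :=
  _root_.Literature.NumberTheory.Sieve.Maynard2016.lemma6MainTerm_holds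

/-- **Maynard (2016), Lemma 6** holds unconditionally (counting + main term).
[cite: Maynard2016LargeGaps, Lemma 6] -/
theorem maynard2016_lemma6_holds : Literature.NumberTheory.Sieve.Maynard2016.Lemma6 :=
  lemma6_of_counting_mainTerm lemma6Counting_holds lemma6MainTerm_holds

end Maynard2016

end Literature.NumberTheory.Sieve

end
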